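import Mathlib.Analysis.Calculus.UniformLimitsDeriv
import Mathlib.Analysis.Calculus.ContDiff.Basic
import HarnessLib

/-!
# Extension of smooth slices, Lipschitz in time to all orders, to the closure of the time set

Analysis/FluidPDE support file (theorems only; no definitions, no named facts), part of the proof
of the named fact `Literature.Analysis.FluidPDE.jia_sverak_2014_local_higher_regularity`
(`JiaSverak2014LocalRegularity.lean`). Pure calculus: let `S ⊆ ℝ` be a set of times, `B` an
open set of a normed space, and `W s : E → F` (`s ∈ S`, `F` complete) slices which are smooth
on `B` with `‖Dᵏ W(s)‖ ≤ C k` on `B` and `‖DᵏW(s)(x) - DᵏW(s')(x)‖ ≤ L k |s - s'|` for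
`s, s' ∈ S`, `x ∈ B`, all `k`. Then the slices extend to every time of the closure of `S`:
there is `U` with `U(s) = W(s)` on `B` for `s ∈ S`, `U(t)` smooth on `B` for `t ∈ S̄` with the
same bounds and the same Lipschitz constants in time on `S̄`, and `U` jointly continuous on
`S̄ × B` (`U(t, x) = lim_{S ∋ s → t} W(s, x)`; derivatives pass to the limit by the uniform
convergence of derivatives, Mathlib `hasFDerivAt_of_tendstoUniformlyOnFilter`). This is the
bookkeeping by which a priori bounds on `∂ₜ ∂ₓ^α u` at almost every time give a representative
with bounded `∂ₜ∂ₓ^α` on the closed time interval (Jia–Šverák 2014, §4: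
`‖∂ₜ∂ₓ^α u‖_{L^∞(B_{1/8}(x₀) × [0,T₂])} ≤ C(α, u₀)`).

* `exists_smooth_extension_of_lipschitz_time` — the statement above.

## References

* H. Jia, V. Šverák, Invent. Math. 196 (2014) = arXiv:1204.0529, §4 proof of Thm 4.1.
  Bib key `JiaSverak2014`.
* W. Rudin, *Principles of Mathematical Analysis*, Thm. 7.17 (uniform convergence and
  differentiation). [folklore]
-/

noncomputable section

open Set Function Filter Metric
open _root_.Topology

namespace Literature.Analysis.FluidPDE

namespace SmoothSlices

variable {E F : Type*} [NormedAddCommGroup E] [NormedSpace ℝ E] [NormedAddCommGroup F]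
  [NormedSpace ℝ F] [CompleteSpace F]

/-- A family `g s` (`s ∈ S`) in a complete space with `‖g s - g s'‖ ≤ L |s - s'|` converges as
`S ∋ s → t` for every `t` in the closure of `S`, and the limit `c` satisfies
`‖c - g s‖ ≤ L |t - s|` for `s ∈ S`. [folklore] -/
theorem exists_tendsto_of_lipschitz {G : Type*} [NormedAddCommGroup G] [CompleteSpace G]
    {S : Set ℝ} {g : ℝ → G} {L : ℝ} (hg : ∀ s ∈ S, ∀ s' ∈ S, ‖g s - g s'‖ ≤ L * |s - s'|)
    {t : ℝ} (ht : t ∈ closure S) :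
    ∃ c : G, Tendsto g (𝓝[S] t) (𝓝 c) ∧ ∀ s ∈ S, ‖c - g s‖ ≤ L * |t - s| := by
  haveI : (𝓝[S] t).NeBot := mem_closure_iff_nhdsWithin_neBot.1 ht
  have hL : ∀ s ∈ S, ∀ s' ∈ S, s ≠ s' → 0 ≤ L := fun s hs s' hs' hne => by
    have h := hg s hs s' hs'
    have hpos : 0 < |s - s'| := abs_pos.2 (sub_ne_zero.2 hne)
    nlinarith [norm_nonneg (g s - g s')]
  have hC : Cauchy (map g (𝓝[S] t)) := by
    refine Metric.cauchy_iff.2 ⟨inferInstance, fun ε hε => ?_⟩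
    set δ : ℝ := ε / (2 * (|L| + 1)) with hδ
    have hδ0 : 0 < δ := by positivity
    refine ⟨g '' (ball t δ ∩ S), image_mem_map (inter_comm S _ ▸ inter_mem_nhdsWithin S (ball_mem_nhds t hδ0)), ?_⟩
    rintro _ ⟨s, ⟨hs, hsS⟩, rfl⟩ _ ⟨s', ⟨hs', hs'S⟩, rfl⟩
    rw [dist_eq_norm]
    have h1 : |s - s'| < 2 * δ := by
      rw [mem_ball, Real.dist_eq] at hs hs'
      calc |s - s'| = |(s - t) - (s' - t)| := by ring_nf
        _ ≤ |s - t| + |s' - t| := abs_sub _ _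
        _ < δ + δ := add_lt_add hs hs'
        _ = 2 * δ := by ring
    calc ‖g s - g s'‖ ≤ L * |s - s'| := hg s hsS s' hs'S
      _ ≤ |L| * |s - s'| := mul_le_mul_of_nonneg_right (le_abs_self L) (abs_nonneg _)
      _ ≤ |L| * (2 * δ) := mul_le_mul_of_nonneg_left h1.le (abs_nonneg L)
      _ = ε * (|L| / (|L| + 1)) := by rw [hδ]; field_simp
      _ < ε := by
          have : |L| / (|L| + 1) < 1 := by rw [div_lt_one (by positivity)]; linarith
          exact mul_lt_of_lt_one_right hε this
  obtain ⟨c, hc0⟩ := CompleteSpace.complete hC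
  have hc : Tendsto g (𝓝[S] t) (𝓝 c) := hc0
  refine ⟨c, hc, fun s hs => ?_⟩
  have h1 : Tendsto (fun s' => ‖g s' - g s‖) (𝓝[S] t) (𝓝 ‖c - g s‖) := (hc.sub tendsto_const_nhds).norm
  have h2 : Tendsto (fun s' => L * |s' - s|) (𝓝[S] t) (𝓝 (L * |t - s|)) :=
    ((continuous_const.mul (continuous_abs.comp (continuous_id.sub continuous_const))).tendsto t).mono_left
      nhdsWithin_le_nhds
  exact le_of_tendsto_of_tendsto h1 h2 (eventually_nhdsWithin_of_forall fun s' hs' => hg s' hs' s hs)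

/-- Limits along `S ∋ s → t` of a Lipschitz-in-time family are Lipschitz on the closure: if
`g s → c` at `t` and `g s → c'` at `t'` (`t, t' ∈ S̄`) then `‖c - c'‖ ≤ L |t - t'|`. [folklore] -/
theorem norm_sub_le_of_tendsto_of_lipschitz {G : Type*} [NormedAddCommGroup G]
    {S : Set ℝ} {g : ℝ → G} {L : ℝ} {t t' : ℝ} {c c' : G}
    (hc : ∀ s ∈ S, ‖c - g s‖ ≤ L * |t - s|) (ht' : t' ∈ closure S) (hc' : Tendsto g (𝓝[S] t') (𝓝 c')) :
    ‖c - c'‖ ≤ L * |t - t'| := by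
  haveI : (𝓝[S] t').NeBot := mem_closure_iff_nhdsWithin_neBot.1 ht'
  have h1 : Tendsto (fun s => ‖c - g s‖) (𝓝[S] t') (𝓝 ‖c - c'‖) := (tendsto_const_nhds.sub hc').norm
  have h2 : Tendsto (fun s => L * |t - s|) (𝓝[S] t') (𝓝 (L * |t - t'|)) :=
    ((continuous_const.mul (continuous_abs.comp (continuous_const.sub continuous_id))).tendsto t').mono_left
      nhdsWithin_le_nhds
  exact le_of_tendsto_of_tendsto h1 h2 (eventually_nhdsWithin_of_forall fun s hs => hc s hs)

/-- Bounds pass to limits along `S ∋ s → t`. [folklore] -/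
theorem norm_le_of_tendsto_of_bound {G : Type*} [NormedAddCommGroup G]
    {S : Set ℝ} {g : ℝ → G} {C : ℝ} {t : ℝ} {c : G} (ht : t ∈ closure S)
    (hc : Tendsto g (𝓝[S] t) (𝓝 c)) (hb : ∀ s ∈ S, ‖g s‖ ≤ C) : ‖c‖ ≤ C := by
  haveI : (𝓝[S] t).NeBot := mem_closure_iff_nhdsWithin_neBot.1 ht
  exact le_of_tendsto hc.norm (eventually_nhdsWithin_of_forall fun s hs => hb s hs)

set_option maxHeartbeats 1600000 in
/-- **Extension of smooth, time-Lipschitz slices to the closure of the time set.** Let `B ⊆ E`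
be open, `S ⊆ ℝ`, and `W s` (`s ∈ S`) smooth on `B` with `‖DᵏW(s)(x)‖ ≤ C k` and
`‖DᵏW(s)(x) - DᵏW(s')(x)‖ ≤ L k |s - s'|` for `x ∈ B`, `s, s' ∈ S`, all `k`. Then there is
`U : ℝ → E → F` with `U s = W s` on `B` for `s ∈ S`; `U t` smooth on `B` for every `t ∈ S̄` with
`‖DᵏU(t)(x)‖ ≤ C k` and `‖DᵏU(t)(x) - DᵏU(t')(x)‖ ≤ L k |t - t'|` for `t, t' ∈ S̄`, `x ∈ B`; and
`U` jointly continuous on `S̄ × B`. [folklore] -/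
theorem exists_smooth_extension_of_lipschitz_time {S : Set ℝ} {B : Set E} (hB : IsOpen B)
    {W : ℝ → E → F} {C L : ℕ → ℝ}
    (hW : ∀ s ∈ S, ContDiffOn ℝ (⊤ : ℕ∞) (W s) B)
    (hC : ∀ k, ∀ s ∈ S, ∀ x ∈ B, ‖iteratedFDeriv ℝ k (W s) x‖ ≤ C k)
    (hL : ∀ k, ∀ s ∈ S, ∀ s' ∈ S, ∀ x ∈ B,
      ‖iteratedFDeriv ℝ k (W s) x - iteratedFDeriv ℝ k (W s') x‖ ≤ L k * |s - s'|) :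
    ∃ U : ℝ → E → F,
      (∀ s ∈ S, ∀ x ∈ B, U s x = W s x) ∧
      (∀ t ∈ closure S, ContDiffOn ℝ (⊤ : ℕ∞) (U t) B) ∧
      (∀ k, ∀ t ∈ closure S, ∀ x ∈ B, ‖iteratedFDeriv ℝ k (U t) x‖ ≤ C k) ∧
      (∀ k, ∀ t ∈ closure S, ∀ t' ∈ closure S, ∀ x ∈ B,
        ‖iteratedFDeriv ℝ k (U t) x - iteratedFDeriv ℝ k (U t') x‖ ≤ L k * |t - t'|) ∧
      ContinuousOn (uncurry U) (closure S ×ˢ B) := by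
  classical
  -- ## Step 1: the limits of all derivatives exist
  have hlim : ∀ k, ∀ t ∈ closure S, ∀ x ∈ B, ∃ c : E [×k]→L[ℝ] F,
      Tendsto (fun s => iteratedFDeriv ℝ k (W s) x) (𝓝[S] t) (𝓝 c) ∧
        ∀ s ∈ S, ‖c - iteratedFDeriv ℝ k (W s) x‖ ≤ L k * |t - s| := fun k t ht x hx =>
    exists_tendsto_of_lipschitz (fun s hs s' hs' => hL k s hs s' hs' x hx) ht
  -- the limit objects `G k t x` (junk outside `S̄ × B`)
  have hGex : ∀ k t x, ∃ c : E [×k]→L[ℝ] F, t ∈ closure S → x ∈ B →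
      Tendsto (fun s => iteratedFDeriv ℝ k (W s) x) (𝓝[S] t) (𝓝 c) ∧
        ∀ s ∈ S, ‖c - iteratedFDeriv ℝ k (W s) x‖ ≤ L k * |t - s| := by
    intro k t x
    by_cases h : t ∈ closure S ∧ x ∈ B
    · obtain ⟨c, hc⟩ := hlim k t h.1 x h.2
      exact ⟨c, fun _ _ => hc⟩
    · exact ⟨0, fun ht hx => (h ⟨ht, hx⟩).elim⟩
  choose G hG using hGex
  have hGt : ∀ k, ∀ t ∈ closure S, ∀ x ∈ B,
      Tendsto (fun s => iteratedFDeriv ℝ k (W s) x) (𝓝[S] t) (𝓝 (G k t x)) := fun k t ht x hx => (hG k t x ht hx).1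
  have hGrate : ∀ k, ∀ t ∈ closure S, ∀ x ∈ B, ∀ s ∈ S,
      ‖G k t x - iteratedFDeriv ℝ k (W s) x‖ ≤ L k * |t - s| := fun k t ht x hx => (hG k t x ht hx).2
  have hGlip : ∀ k, ∀ t ∈ closure S, ∀ t' ∈ closure S, ∀ x ∈ B, ‖G k t x - G k t' x‖ ≤ L k * |t - t'| :=
    fun k t ht t' ht' x hx => norm_sub_le_of_tendsto_of_lipschitz (hGrate k t ht x hx) ht' (hGt k t' ht' x hx)
  have hGbd : ∀ k, ∀ t ∈ closure S, ∀ x ∈ B, ‖G k t x‖ ≤ C k := fun k t ht x hx =>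
    norm_le_of_tendsto_of_bound ht (hGt k t ht x hx) fun s hs => hC k s hs x hx
  -- on `S` the limit is the slice itself
  have hGS : ∀ k, ∀ s ∈ S, ∀ x ∈ B, G k s x = iteratedFDeriv ℝ k (W s) x := by
    intro k s hs x hx
    have h := hGrate k s (subset_closure hs) x hx s hs
    rw [sub_self, abs_zero, mul_zero] at h
    exact sub_eq_zero.1 (norm_le_zero_iff.1 h)
  -- ## Step 2: the function `U` and its derivatives
  set U : ℝ → E → F := fun t x => (continuousMultilinearCurryFin0 ℝ E F) (G 0 t x) with hU
  have hU0 : ∀ t x, iteratedFDeriv ℝ 0 (U t) x = G 0 t x := by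
    intro t x
    ext m
    rw [iteratedFDeriv_zero_apply, hU]
    simp only [continuousMultilinearCurryFin0_apply]
    congr 1
    exact Subsingleton.elim _ _
  -- the key induction: `Dᵏ(U t) = G k t` on `B`, with the derivative of `Dᵏ(U t)` given by `G (k+1) t`
  have hkey : ∀ t ∈ closure S, ∀ k, (∀ x ∈ B, iteratedFDeriv ℝ k (U t) x = G k t x) ∧
      ∀ x ∈ B, HasFDerivAt (iteratedFDeriv ℝ k (U t))
        ((continuousMultilinearCurryLeftEquiv ℝ (fun _ : Fin (k + 1) => E) F) (G (k + 1) t x)) x := by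
    intro t ht
    haveI : (𝓝[S] t).NeBot := mem_closure_iff_nhdsWithin_neBot.1 ht
    -- the derivative statement for `G k t` from the uniform convergence of derivatives
    have hderiv : ∀ k, ∀ x ∈ B, HasFDerivAt (G k t)
        ((continuousMultilinearCurryLeftEquiv ℝ (fun _ : Fin (k + 1) => E) F) (G (k + 1) t x)) x := by
      intro k x hx
      set ι := continuousMultilinearCurryLeftEquiv ℝ (fun _ : Fin (k + 1) => E) F with hι
      refine hasFDerivAt_of_tendstoUniformlyOnFilter (l := 𝓝[S] t)
        (f := fun s => iteratedFDeriv ℝ k (W s)) (f' := fun s y => fderiv ℝ (iteratedFDeriv ℝ k (W s)) y)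
        (g' := fun y => ι (G (k + 1) t y)) ?_ ?_ ?_
      · -- uniform convergence of the derivatives near `x`
        rw [Metric.tendstoUniformlyOnFilter_iff]
        intro ε hε
        set δ : ℝ := ε / (2 * (|L (k + 1)| + 1)) with hδ
        have hδ0 : 0 < δ := by positivity
        have h1 : ∀ᶠ n : ℝ × E in (𝓝[S] t) ×ˢ 𝓝 x, n.1 ∈ ball t δ ∩ S ∧ n.2 ∈ B :=
          Filter.prod_mem_prod (inter_comm S _ ▸ inter_mem_nhdsWithin S (ball_mem_nhds t hδ0)) (hB.mem_nhds hx)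
        filter_upwards [h1] with n hn
        obtain ⟨⟨hn1, hnS⟩, hn2⟩ := hn
        rw [dist_eq_norm]
        have e1 : fderiv ℝ (iteratedFDeriv ℝ k (W n.1)) n.2 = ι (iteratedFDeriv ℝ (k + 1) (W n.1) n.2) := by
          rw [fderiv_iteratedFDeriv]; rfl
        rw [e1, ← LinearIsometryEquiv.map_sub, LinearIsometryEquiv.norm_map]
        rw [mem_ball, Real.dist_eq] at hn1
        calc ‖G (k + 1) t n.2 - iteratedFDeriv ℝ (k + 1) (W n.1) n.2‖ ≤ L (k + 1) * |t - n.1| :=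
              hGrate (k + 1) t ht n.2 hn2 n.1 hnS
          _ ≤ |L (k + 1)| * |t - n.1| := mul_le_mul_of_nonneg_right (le_abs_self _) (abs_nonneg _)
          _ ≤ |L (k + 1)| * δ := by
              refine mul_le_mul_of_nonneg_left ?_ (abs_nonneg _)
              rw [abs_sub_comm]; exact hn1.le
          _ = ε / 2 * (|L (k + 1)| / (|L (k + 1)| + 1)) := by rw [hδ]; field_simp
          _ < ε := by
              have h2 : |L (k + 1)| / (|L (k + 1)| + 1) < 1 := by rw [div_lt_one (by positivity)]; linarith
              have h3 : 0 ≤ |L (k + 1)| / (|L (k + 1)| + 1) := by positivity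
              nlinarith
      · -- the slices are differentiable near `x` for `s ∈ S`
        have h1 : ∀ᶠ n : ℝ × E in (𝓝[S] t) ×ˢ 𝓝 x, n.1 ∈ S ∧ n.2 ∈ B :=
          Filter.prod_mem_prod self_mem_nhdsWithin (hB.mem_nhds hx)
        filter_upwards [h1] with n hn
        have hcd : ContDiffAt ℝ (⊤ : ℕ∞) (W n.1) n.2 := (hW n.1 hn.1).contDiffAt (hB.mem_nhds hn.2)
        exact (hcd.differentiableAt_iteratedFDeriv (by exact_mod_cast ENat.coe_lt_top k)).hasFDerivAt
      · -- pointwise convergence near `x`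
        filter_upwards [hB.mem_nhds hx] with y hy
        exact hGt k t ht y hy
    intro k
    induction k with
    | zero =>
      refine ⟨fun x hx => hU0 t x, fun x hx => ?_⟩
      have heq : iteratedFDeriv ℝ 0 (U t) = G 0 t := funext fun y => hU0 t y
      rw [heq]
      exact hderiv 0 x hx
    | succ k ih =>
      have hD : ∀ x ∈ B, iteratedFDeriv ℝ (k + 1) (U t) x = G (k + 1) t x := by
        intro x hx
        have h1 := (ih.2 x hx).fderiv
        rw [iteratedFDeriv_succ_eq_comp_left, Function.comp_apply, h1]
        exact (continuousMultilinearCurryLeftEquiv ℝ (fun _ : Fin (k + 1) => E) F).symm_apply_apply _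
      refine ⟨hD, fun x hx => ?_⟩
      have heq : iteratedFDeriv ℝ (k + 1) (U t) =ᶠ[𝓝 x] G (k + 1) t := by
        filter_upwards [hB.mem_nhds hx] with y hy
        exact hD y hy
      exact (hderiv (k + 1) x hx).congr_of_eventuallyEq heq
  -- ## Step 3: the conclusions
  have hUD : ∀ t ∈ closure S, ∀ k, ∀ x ∈ B, iteratedFDeriv ℝ k (U t) x = G k t x := fun t ht k => (hkey t ht k).1
  have hUS : ∀ s ∈ S, ∀ x ∈ B, U s x = W s x := by
    intro s hs x hx
    have h := hUD s (subset_closure hs) 0 x hx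
    rw [hGS 0 s hs x hx] at h
    have h' := congrArg (fun M : E [×0]→L[ℝ] F => M 0) h
    simpa only [iteratedFDeriv_zero_apply] using h'
  have hsmooth : ∀ t ∈ closure S, ContDiffOn ℝ (⊤ : ℕ∞) (U t) B := by
    intro t ht
    refine contDiffOn_of_differentiableOn fun m _ => ?_
    have hd : DifferentiableOn ℝ (iteratedFDeriv ℝ m (U t)) B := fun x hx =>
      ((hkey t ht m).2 x hx).differentiableAt.differentiableWithinAt
    exact hd.congr fun x hx => (iteratedFDerivWithin_of_isOpen m hB hx)
  have hcontU : ∀ t ∈ closure S, ContinuousOn (U t) B := fun t ht => (hsmooth t ht).continuousOn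
  refine ⟨U, hUS, hsmooth, fun k t ht x hx => ?_, fun k t ht t' ht' x hx => ?_, ?_⟩
  · rw [hUD t ht k x hx]; exact hGbd k t ht x hx
  · rw [hUD t ht k x hx, hUD t' ht' k x hx]; exact hGlip k t ht t' ht' x hx
  · -- joint continuity on `S̄ × B`
    rintro ⟨t, x⟩ ⟨ht, hx⟩
    rw [ContinuousWithinAt, Metric.tendsto_nhds]
    intro ε hε
    have hL0 : ∀ t₁ ∈ closure S, ∀ t₂ ∈ closure S, ∀ y ∈ B, ‖U t₁ y - U t₂ y‖ ≤ L 0 * |t₁ - t₂| := by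
      intro t₁ h₁ t₂ h₂ y hy
      have h := hGlip 0 t₁ h₁ t₂ h₂ y hy
      have e : ‖iteratedFDeriv ℝ 0 (U t₁) y - iteratedFDeriv ℝ 0 (U t₂) y‖ = ‖U t₁ y - U t₂ y‖ := by
        rw [iteratedFDeriv_zero_eq_comp, iteratedFDeriv_zero_eq_comp, Function.comp_apply, Function.comp_apply,
          ← map_sub, LinearIsometryEquiv.norm_map]
      rwa [← hUD t₁ h₁ 0 y hy, ← hUD t₂ h₂ 0 y hy, e] at h
    -- spatial continuity of `U t` at `x`
    have hsc : ∀ᶠ y in 𝓝[B] x, dist (U t y) (U t x) < ε / 2 :=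
      Metric.tendsto_nhds.1 ((hcontU t ht).continuousWithinAt hx) _ (by positivity)
    obtain ⟨O, hO, hOb⟩ : ∃ O ∈ 𝓝 x, ∀ y ∈ O ∩ B, dist (U t y) (U t x) < ε / 2 := by
      obtain ⟨O, hO, hOB⟩ := mem_nhdsWithin_iff_exists_mem_nhds_inter.1 hsc
      exact ⟨O, hO, fun y hy => hOB hy⟩
    set δ : ℝ := ε / (2 * (|L 0| + 1)) with hδ
    have hδ0 : 0 < δ := by positivity
    have hN : ball t δ ×ˢ O ∈ 𝓝 (t, x) := prod_mem_nhds (ball_mem_nhds t hδ0) hO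
    refine mem_nhdsWithin_iff_exists_mem_nhds_inter.2 ⟨ball t δ ×ˢ O, hN, ?_⟩
    rintro ⟨t', x'⟩ ⟨⟨ht'δ, hx'O⟩, ht', hx'⟩
    simp only [mem_setOf_eq, uncurry]
    rw [dist_eq_norm]
    have h1 : ‖U t' x' - U t x'‖ ≤ L 0 * |t' - t| := hL0 t' ht' t ht x' hx'
    have h2 : dist (U t x') (U t x) < ε / 2 := hOb x' ⟨hx'O, hx'⟩
    rw [dist_eq_norm] at h2
    rw [mem_ball, Real.dist_eq] at ht'δ
    have h3 : L 0 * |t' - t| < ε / 2 := by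
      calc L 0 * |t' - t| ≤ |L 0| * |t' - t| := mul_le_mul_of_nonneg_right (le_abs_self _) (abs_nonneg _)
        _ ≤ |L 0| * δ := mul_le_mul_of_nonneg_left ht'δ.le (abs_nonneg _)
        _ = ε / 2 * (|L 0| / (|L 0| + 1)) := by rw [hδ]; field_simp
        _ < ε / 2 := by
            have h4 : |L 0| / (|L 0| + 1) < 1 := by rw [div_lt_one (by positivity)]; linarith
            exact mul_lt_of_lt_one_right (by positivity) h4
    calc ‖U t' x' - U t x‖ = ‖(U t' x' - U t x') + (U t x' - U t x)‖ := by abel_nf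
      _ ≤ ‖U t' x' - U t x'‖ + ‖U t x' - U t x‖ := norm_add_le _ _
      _ < ε / 2 + ε / 2 := add_lt_add (h1.trans_lt h3) h2
      _ = ε := by ring
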